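import Summits.QuantumFields.YangMills.Theorems.UnitScaleTiltProp7DirichletOfOffsetFamily
import Summits.QuantumFields.YangMills.Theorems.UnitScaleTiltProp7LemmaHCurvedDirichletCountExact
import HarnessLib

/-!
# Route `UnitScaleTilt`, crux K1 «MinimiserStabilityRegPr» (stmt-QuantumFields-19200), route-R E′ path (α′), S3 K-form engine, (H)-RED-1′ «hDir ⟸ hKg′-K(fam)» — FILE 9s″ (T³ letters):
# THE EXACT-WEIGHT TWIN OF ✓p680787 — the supported covariant Dirichlet energy of the h-averaged offset-comb local models is at most the averaged-path (Kg′) family WITH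
# EXACT MULTIPLICITIES `Σ_y ℓ′⁻¹Σ_h 2·Σ_μ Σ_(i<|t_μ|) Σ_(q∈[−R,R]^d) (W⁺_(μ,i)(q)·‖[P̃⁺, φ₀(c_y)]‖² + W⁻_(μ,i)(q)·‖[P̃⁻, φ₀(c_y)]‖²)` (trunk-supported filtered box sums of ✓ `Prop7CombLadderCountExact`,
# ✓p678641∕p678898∕p679820) instead of the sup weights `(|t_μ|R)·(2R+1)^(|t_μ|−i)` — «px9's exact-weight twin swaps in later» (★p1 g16 NAMER WORD 13, v5 spec; routeR-w1 g6's header of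
# ✓p680787: «the exact-weight twin is px9 g4's one-line swap (✓p679028 in place of ✓ `sum_ite_comm_loopT_sq_le_canonical`)»)

Cell `ym3-torus`, width seat `ym3-torus-px9` (gen 4); statements = ✓p680787's two theorems with ONLY the family block replaced; proofs = ✓p680787's with ✓p679028 swapped in.
THEOREMS ONLY (0 `def`, 0 `sorry`); `--supports stmt-QuantumFields-19200 --as helper`, count-neutral.  YM₃ on T³ is a RUNG of the ladder (R3) — not d = 4, not infinite volume, not a mass
gap, not the Clay problem; nothing here claims a stub, the crux or any summit statement.

WHAT IS PROVED (ns `…Theorems.Prop7DirichletOfOffsetFamilyExact`).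
* §1 ★★ `dirichlet_avg_axial_le_canonical_exact` — any torus, any averaged axial family (bases `C`, data `M`, geometry rows `hgeo`, splits): `Σ_z [N z] Σ_μ (‖D*Ψ̄‖² + ‖DΨ̄‖²) ≤
  |H|⁻¹Σ_η 2·Σ_μ Σ_i Σ_q (W⁺·f⁺ + W⁻·f⁻)` (convexity ✓ `norm_sq_covD[star]_avg_le` ∘ axial rows ✓ `norm_covD[star]_axialModel_le` ∘ ✓ `sum_ite_sum_mul_sum_comm` ∘ ✓p679028).
* §2 ★★★ `dirichlet_offsetFamily_le_transported_exact` — T³, the offset-comb family, window rows discharged (✓ `abs_rel_offset_le`), letters transported (✓ `canonical_letter_eq_transported`);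
  for the v5 knit: `hDir ⟸ hKg′-K(R4′-fam, exact weights)` is ONE `le_trans` against this theorem, exactly as with ✓p680787 for the sup-weight row.
HONEST SCOPE.  Re-assembly of landed bricks; no estimate of the series; no booking against `K_gauge`.

References: T. Bałaban, CMP 99 (1985) 389–434 [Balaban1985BackgroundPropagators] ((3.3) p.390, (3.8) p.392); CMP 98 (1985) 17–51 [Balaban1985Averaging] ((9) p.18, (19)–(20) p.21,
p.24); CMP 102 (1985) 255–275 [Balaban1985UV3] ((27) p.263).
-/

set_option autoImplicit false

noncomputable section

open scoped BigOperators Matrix.Norms.L2Operator Matrix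

namespace Summit.QuantumFields.YangMills.Theorems.Prop7DirichletOfOffsetFamilyExact

open Literature.MathematicalPhysics.QuantumFieldTheory.Balaban1983to89
open Literature.MathematicalPhysics.QuantumFieldTheory.Balaban1983to89.T3ContinuumYM3Torus
open B7Prop1Explicit (Letter e seg treeWord hol)
open B10Eq27AxialLog (contour27)
open B9Eq39Adjoint (R covD covDstar divB)
open B9TorusCalculus (torusT)
open B10Eq27TorusAxialLog (unitsField toUField holT axialT contourT rel pull transl)
open B5Eq118OneStroke (iterBlockOf)
open B15DeterminingSets (embIter)
open Summit.QuantumFields.YangMills.Theorems.Prop7CovHodgeSplit (unitsField_toUField_mem_unitary)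
open Summit.QuantumFields.YangMills.Theorems.Prop7LemmaHCurvedOfRows (bicontr_of_mem_unitary)
open Summit.QuantumFields.YangMills.Theorems.Prop7AxialLocalModel (norm_covD_axialModel_le norm_covDstar_axialModel_le)
open Summit.QuantumFields.YangMills.Theorems.Prop7LocalModelAverage (norm_sq_covD_avg_le norm_sq_covDstar_avg_le)
open Summit.QuantumFields.YangMills.Theorems.Prop7LemmaHCurvedDirichletCount (sum_ite_sum_mul_sum_comm)
open Summit.QuantumFields.YangMills.Theorems.Prop7LemmaHCurvedDirichletCountExact (sum_ite_comm_loopT_sq_le_canonical_exact)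
open Summit.QuantumFields.YangMills.Theorems.Prop7OffsetFamilyWindow (abs_rel_offset_le)
open Summit.QuantumFields.YangMills.Theorems.Prop7OffsetFamilyTransported (canonical_letter_eq_transported)

/-! ## §1 Any averaged axial family on a torus, exact weights -/

section Torus

variable {𝔸 : Type*} [NormedRing 𝔸] [NormedAlgebra ℝ 𝔸] [NormOneClass 𝔸] {P : Params} {j : ℕ} (V : GaugeField P j 𝔸ˣ)
  (hV : ∀ b : PBond P j, ‖(V b : 𝔸)‖ ≤ 1 ∧ ‖(((V b)⁻¹ : 𝔸ˣ) : 𝔸)‖ ≤ 1)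

include hV in
/-- ★★ **THE SUPPORTED DIRICHLET ENERGY OF AN AVERAGED AXIAL FAMILY IN CANONICAL LETTERS, EXACT WEIGHTS** (per block; twin of ✓ `dirichlet_avg_axial_le_canonical`):
`Σ_z [N z] Σ_μ (‖D*_V Ψ̄(z,μ)‖² + ‖D_V Ψ̄(z,μ)‖²) ≤ |H|⁻¹Σ_η 2·Σ_μ Σ_(i<|t_μ|) Σ_(q∈[−R,R]^d) (W⁺_(μ,i)(q)·f_η(q,(t_(μ,i),+)) + W⁻_(μ,i)(q)·f_η(q,(t_(μ,i),−)))`, the weights the EXACT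
trunk-supported filtered box sums of ✓ `Prop7CombLadderCountExact` with the Cauchy–Schwarz weight `|B_μ(v)|` inside; geometry rows displayed as `hgeo`.
[cite: Balaban1985BackgroundPropagators, (3.3) p.390, (3.8) p.392] [cite: Balaban1985UV3, (27) p.263] [cite: Balaban1985Averaging, (9) p.18, (19)–(20) p.21, p.24] -/
theorem dirichlet_avg_axial_le_canonical_exact {H : Type*} [Fintype H] [Nonempty H] (C : H → Site P j) (M : H → 𝔸) (N : Site P j → Prop) [DecidablePred N] (R₀ : ℕ)
    (hgeo : ∀ z, N z → ∀ (η : H) (μ ν : Fin P.d), |rel (C η) z ν| ≤ (R₀ : ℤ) ∧ |rel (C η) ((torusT P j μ).symm z) ν| ≤ (R₀ : ℤ)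
      ∧ (rel (C η) z ν + 1) * 2 ≤ (P.sitesPerDir j : ℤ) ∧ (rel (C η) ((torusT P j μ).symm z) ν + 1) * 2 ≤ (P.sitesPerDir j : ℤ))
    (s t : Fin P.d → List (Fin P.d)) (hsplit : ∀ μ, (List.finRange P.d).reverse = s μ ++ μ :: t μ) (hs : ∀ μ, μ ∉ s μ) (ht : ∀ μ, μ ∉ t μ) :
    ∑ z : Site P j, (if N z then ∑ μ : Fin P.d,
        (‖covDstar (torusT P j) (fun κ z => V ⟨z, κ⟩) μ (fun z => (Fintype.card H : ℝ)⁻¹ • ∑ η, R (axialT V (C η) z)⁻¹ (M η)) z‖ ^ 2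
          + ‖covD (torusT P j) (fun κ z => V ⟨z, κ⟩) μ (fun z => (Fintype.card H : ℝ)⁻¹ • ∑ η, R (axialT V (C η) z)⁻¹ (M η)) z‖ ^ 2) else 0)
      ≤ (Fintype.card H : ℝ)⁻¹ * ∑ η, (2 * ∑ μ : Fin P.d, ∑ i ∈ Finset.range (t μ).length, ∑ q ∈ Fintype.piFinset (fun _ : Fin P.d => Finset.Icc (-(R₀ : ℤ)) (R₀ : ℤ)),
                                                            ((∑ v ∈ (Fintype.piFinset (fun _ : Fin P.d => Finset.Icc (-(R₀ : ℤ)) (R₀ : ℤ))).filter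
                                                                (fun v => (∀ ν ∈ ((t μ).take i).foldl (fun S ν => insert ν S) (insert μ (s μ).toFinset), q ν = v ν)
                                                                  ∧ (∀ ν, ν ∉ ((t μ).take i).foldl (fun S ν => insert ν S) (insert μ (s μ).toFinset) → ν ≠ (t μ).getD i μ → q ν = 0)
                                                                  ∧ 0 ≤ q ((t μ).getD i μ) ∧ q ((t μ).getD i μ) < v ((t μ).getD i μ)), ((((t μ).flatMap (fun κ => seg κ (v κ))).length : ℕ) : ℝ))
                                                              * ‖((hol (pull V (C η)) q [((t μ).getD i μ, true), (μ, true), Letter.rev ((t μ).getD i μ, true), (μ, false)] : 𝔸ˣ) : 𝔸)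
                    * R (hol (pull V (C η)) 0 (treeWord q))⁻¹ (M η)
                  - R (hol (pull V (C η)) 0 (treeWord q))⁻¹ (M η)
                    * ((hol (pull V (C η)) q [((t μ).getD i μ, true), (μ, true), Letter.rev ((t μ).getD i μ, true), (μ, false)] : 𝔸ˣ) : 𝔸)‖ ^ 2
                                                            + (∑ v ∈ (Fintype.piFinset (fun _ : Fin P.d => Finset.Icc (-(R₀ : ℤ)) (R₀ : ℤ))).filter
                                                                (fun v => (∀ ν ∈ ((t μ).take i).foldl (fun S ν => insert ν S) (insert μ (s μ).toFinset), q ν = v ν)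
                                                                  ∧ (∀ ν, ν ∉ ((t μ).take i).foldl (fun S ν => insert ν S) (insert μ (s μ).toFinset) → ν ≠ (t μ).getD i μ → q ν = 0)
                                                                  ∧ v ((t μ).getD i μ) < q ((t μ).getD i μ) ∧ q ((t μ).getD i μ) ≤ 0), ((((t μ).flatMap (fun κ => seg κ (v κ))).length : ℕ) : ℝ))
                                                              * ‖((hol (pull V (C η)) q [((t μ).getD i μ, false), (μ, true), Letter.rev ((t μ).getD i μ, false), (μ, false)] : 𝔸ˣ) : 𝔸)
                    * R (hol (pull V (C η)) 0 (treeWord q))⁻¹ (M η)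
                  - R (hol (pull V (C η)) 0 (treeWord q))⁻¹ (M η)
                    * ((hol (pull V (C η)) q [((t μ).getD i μ, false), (μ, true), Letter.rev ((t μ).getD i μ, false), (μ, false)] : 𝔸ˣ) : 𝔸)‖ ^ 2)) := by
  have hc0 : (0 : ℝ) ≤ (Fintype.card H : ℝ)⁻¹ := by positivity
  have step1 : ∀ z, N z → ∀ μ : Fin P.d,
      ‖covDstar (torusT P j) (fun κ z => V ⟨z, κ⟩) μ (fun z => (Fintype.card H : ℝ)⁻¹ • ∑ η, R (axialT V (C η) z)⁻¹ (M η)) z‖ ^ 2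
        + ‖covD (torusT P j) (fun κ z => V ⟨z, κ⟩) μ (fun z => (Fintype.card H : ℝ)⁻¹ • ∑ η, R (axialT V (C η) z)⁻¹ (M η)) z‖ ^ 2
      ≤ (Fintype.card H : ℝ)⁻¹ * ∑ η,
          (‖((holT V (C η) (contourT (C η) ⟨(torusT P j μ).symm z, μ⟩) : 𝔸ˣ) : 𝔸) * M η - M η * ((holT V (C η) (contourT (C η) ⟨(torusT P j μ).symm z, μ⟩) : 𝔸ˣ) : 𝔸)‖ ^ 2
            + ‖((holT V (C η) (contourT (C η) ⟨z, μ⟩) : 𝔸ˣ) : 𝔸) * M η - M η * ((holT V (C η) (contourT (C η) ⟨z, μ⟩) : 𝔸ˣ) : 𝔸)‖ ^ 2) := by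
    intro z hz μ
    have cv1 := norm_sq_covDstar_avg_le (torusT P j) (fun κ z => V ⟨z, κ⟩) (fun η z => R (axialT V (C η) z)⁻¹ (M η)) μ z
    have cv2 := norm_sq_covD_avg_le (torusT P j) (fun κ z => V ⟨z, κ⟩) (fun η z => R (axialT V (C η) z)⁻¹ (M η)) μ z
    refine (add_le_add cv1 cv2).trans ?_
    rw [← mul_add, ← Finset.sum_add_distrib]
    refine mul_le_mul_of_nonneg_left (Finset.sum_le_sum fun η _ => add_le_add ?_ ?_) hc0
    · exact pow_le_pow_left₀ (norm_nonneg _) (norm_covDstar_axialModel_le V hV (C η) (M η) μ z (hgeo z hz η μ μ).2.2.2) 2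
    · exact pow_le_pow_left₀ (norm_nonneg _) (norm_covD_axialModel_le V hV (C η) (M η) μ z (hgeo z hz η μ μ).2.2.1) 2
  have step2 : ∑ z : Site P j, (if N z then ∑ μ : Fin P.d,
        (‖covDstar (torusT P j) (fun κ z => V ⟨z, κ⟩) μ (fun z => (Fintype.card H : ℝ)⁻¹ • ∑ η, R (axialT V (C η) z)⁻¹ (M η)) z‖ ^ 2
          + ‖covD (torusT P j) (fun κ z => V ⟨z, κ⟩) μ (fun z => (Fintype.card H : ℝ)⁻¹ • ∑ η, R (axialT V (C η) z)⁻¹ (M η)) z‖ ^ 2) else 0)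
      ≤ ∑ z : Site P j, (if N z then ∑ μ : Fin P.d, (Fintype.card H : ℝ)⁻¹ * ∑ η,
          (‖((holT V (C η) (contourT (C η) ⟨(torusT P j μ).symm z, μ⟩) : 𝔸ˣ) : 𝔸) * M η - M η * ((holT V (C η) (contourT (C η) ⟨(torusT P j μ).symm z, μ⟩) : 𝔸ˣ) : 𝔸)‖ ^ 2
            + ‖((holT V (C η) (contourT (C η) ⟨z, μ⟩) : 𝔸ˣ) : 𝔸) * M η - M η * ((holT V (C η) (contourT (C η) ⟨z, μ⟩) : 𝔸ˣ) : 𝔸)‖ ^ 2) else 0) :=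
    Finset.sum_le_sum fun z _ => by
      split_ifs with hz
      · exact Finset.sum_le_sum fun μ _ => step1 z hz μ
      · exact le_rfl
  rw [sum_ite_sum_mul_sum_comm] at step2
  refine step2.trans (mul_le_mul_of_nonneg_left (Finset.sum_le_sum fun η _ => ?_) hc0)
  exact sum_ite_comm_loopT_sq_le_canonical_exact V hV (C η) (M η) N R₀ (fun z hz μ ν => ⟨(hgeo z hz η μ ν).1, (hgeo z hz η μ ν).2.1⟩) s t hsplit hs ht

end Torus

/-! ## §2 The offset-comb family on T³: hDir's left side ≤ the (Kg′) family with EXACT weights, transported-plaquette letters -/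

section T3

/-- ★★★ **hDir ⟸ hKg′-K(fam, EXACT WEIGHTS), UNCONDITIONAL PART** (twin of ✓ `dirichlet_offsetFamily_le_transported`): for the h-averaged offset-comb local models the supported
covariant Dirichlet energy is at most the averaged-path (Kg′) family with the EXACT multiplicities `W^±_(μ,i)(q)` (`R = 2ℓ + ℓ′`, window `2(2ℓ+ℓ′) < N`), letters transported to the centres:
`P̃ = R(𝒲(c_y;[ι]^h ++ Γ_(0,q)))·𝒲_(c^h_y+q)(rung word)`. [cite: Balaban1985BackgroundPropagators, (3.3) p.390, (3.8) p.392] [cite: Balaban1985Averaging, (9) p.18, (19)–(20) p.21, p.24]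
[cite: Balaban1985UV3, (27) p.263] -/
theorem dirichlet_offsetFamily_le_transported_exact (F : T3Family) (K n : ℕ) (hk : K - n ≤ (F.P K).m + (F.P K).K)
    (W : GaugeField (F.P K) 0 (Matrix.specialUnitaryGroup (Fin 2) ℂ)) (ψ : Site (F.P K) 0 → Matrix (Fin 2) (Fin 2) ℂ)
    (ι : Fin (F.P K).d) (ℓ' : ℕ) [NeZero ℓ'] (hN : (2 * (F.P K).L ^ (K - n) + ℓ') * 2 < (F.P K).sitesPerDir 0)
    (s t : Fin (F.P K).d → List (Fin (F.P K).d)) (hsplit : ∀ μ, (List.finRange (F.P K).d).reverse = s μ ++ μ :: t μ) (hs : ∀ μ, μ ∉ s μ) (ht : ∀ μ, μ ∉ t μ) :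
    ∑ y : Site (F.P K) (K - n), ∑ z : Site (F.P K) 0,
      (if (∀ ν : Fin (F.P K).d,
          (y ν = (iterBlockOf (K - n) (fun κ => z κ - (((((F.P K).L ^ (K - n) - 1) / 2 : ℕ)) : ZMod ((F.P K).sitesPerDir 0)))) ν - 1
          ∨ y ν = (iterBlockOf (K - n) (fun κ => z κ - (((((F.P K).L ^ (K - n) - 1) / 2 : ℕ)) : ZMod ((F.P K).sitesPerDir 0)))) ν
          ∨ y ν = (iterBlockOf (K - n) (fun κ => z κ - (((((F.P K).L ^ (K - n) - 1) / 2 : ℕ)) : ZMod ((F.P K).sitesPerDir 0)))) ν + 1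
          ∨ y ν = (iterBlockOf (K - n) (fun κ => z κ - (((((F.P K).L ^ (K - n) - 1) / 2 : ℕ)) : ZMod ((F.P K).sitesPerDir 0)))) ν + 2))
        then ∑ μ : Fin (F.P K).d,
          (‖covDstar (torusT (F.P K) 0) (fun κ z => unitsField (toUField W) ⟨z, κ⟩) μ
              (fun z => (ℓ' : ℝ)⁻¹ • ∑ η : Fin ℓ', R (axialT (unitsField (toUField W)) (transl (embIter (K - n) y) (((η : ℕ) : ℤ) • e ι)) z)⁻¹ (R (holT (unitsField (toUField W)) (embIter (K - n) y) (seg ι ((η : ℕ) : ℤ)))⁻¹ (ψ (embIter (K - n) y)))) z‖ ^ 2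
            + ‖covD (torusT (F.P K) 0) (fun κ z => unitsField (toUField W) ⟨z, κ⟩) μ
              (fun z => (ℓ' : ℝ)⁻¹ • ∑ η : Fin ℓ', R (axialT (unitsField (toUField W)) (transl (embIter (K - n) y) (((η : ℕ) : ℤ) • e ι)) z)⁻¹ (R (holT (unitsField (toUField W)) (embIter (K - n) y) (seg ι ((η : ℕ) : ℤ)))⁻¹ (ψ (embIter (K - n) y)))) z‖ ^ 2) else 0)
      ≤ ∑ y : Site (F.P K) (K - n), (ℓ' : ℝ)⁻¹ * ∑ η : Fin ℓ', (2 * ∑ μ : Fin (F.P K).d,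
              ∑ i ∈ Finset.range (t μ).length, ∑ q ∈ Fintype.piFinset (fun _ : Fin (F.P K).d => Finset.Icc (-((2 * (F.P K).L ^ (K - n) + ℓ') : ℤ)) ((2 * (F.P K).L ^ (K - n) + ℓ') : ℤ)),
                ((∑ v ∈ (Fintype.piFinset (fun _ : Fin (F.P K).d => Finset.Icc (-((2 * (F.P K).L ^ (K - n) + ℓ') : ℤ)) ((2 * (F.P K).L ^ (K - n) + ℓ') : ℤ))).filter
                    (fun v => (∀ ν ∈ ((t μ).take i).foldl (fun S ν => insert ν S) (insert μ (s μ).toFinset), q ν = v ν)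
                      ∧ (∀ ν, ν ∉ ((t μ).take i).foldl (fun S ν => insert ν S) (insert μ (s μ).toFinset) → ν ≠ (t μ).getD i μ → q ν = 0)
                      ∧ 0 ≤ q ((t μ).getD i μ) ∧ q ((t μ).getD i μ) < v ((t μ).getD i μ)), ((((t μ).flatMap (fun κ => seg κ (v κ))).length : ℕ) : ℝ))
                  * ‖R (holT (unitsField (toUField W)) (embIter (K - n) y) (seg ι ((η : ℕ) : ℤ) ++ treeWord q))
                          ((holT (unitsField (toUField W)) (transl (transl (embIter (K - n) y) (((η : ℕ) : ℤ) • e ι)) q) [((t μ).getD i μ, true), (μ, true), Letter.rev ((t μ).getD i μ, true), (μ, false)] : (Matrix (Fin 2) (Fin 2) ℂ)ˣ) : Matrix (Fin 2) (Fin 2) ℂ)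
                        * ψ (embIter (K - n) y)
                      - ψ (embIter (K - n) y)
                        * R (holT (unitsField (toUField W)) (embIter (K - n) y) (seg ι ((η : ℕ) : ℤ) ++ treeWord q))
                          ((holT (unitsField (toUField W)) (transl (transl (embIter (K - n) y) (((η : ℕ) : ℤ) • e ι)) q) [((t μ).getD i μ, true), (μ, true), Letter.rev ((t μ).getD i μ, true), (μ, false)] : (Matrix (Fin 2) (Fin 2) ℂ)ˣ) : Matrix (Fin 2) (Fin 2) ℂ)‖ ^ 2
                + (∑ v ∈ (Fintype.piFinset (fun _ : Fin (F.P K).d => Finset.Icc (-((2 * (F.P K).L ^ (K - n) + ℓ') : ℤ)) ((2 * (F.P K).L ^ (K - n) + ℓ') : ℤ))).filter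
                    (fun v => (∀ ν ∈ ((t μ).take i).foldl (fun S ν => insert ν S) (insert μ (s μ).toFinset), q ν = v ν)
                      ∧ (∀ ν, ν ∉ ((t μ).take i).foldl (fun S ν => insert ν S) (insert μ (s μ).toFinset) → ν ≠ (t μ).getD i μ → q ν = 0)
                      ∧ v ((t μ).getD i μ) < q ((t μ).getD i μ) ∧ q ((t μ).getD i μ) ≤ 0), ((((t μ).flatMap (fun κ => seg κ (v κ))).length : ℕ) : ℝ))
                  * ‖R (holT (unitsField (toUField W)) (embIter (K - n) y) (seg ι ((η : ℕ) : ℤ) ++ treeWord q))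
                          ((holT (unitsField (toUField W)) (transl (transl (embIter (K - n) y) (((η : ℕ) : ℤ) • e ι)) q) [((t μ).getD i μ, false), (μ, true), Letter.rev ((t μ).getD i μ, false), (μ, false)] : (Matrix (Fin 2) (Fin 2) ℂ)ˣ) : Matrix (Fin 2) (Fin 2) ℂ)
                        * ψ (embIter (K - n) y)
                      - ψ (embIter (K - n) y)
                        * R (holT (unitsField (toUField W)) (embIter (K - n) y) (seg ι ((η : ℕ) : ℤ) ++ treeWord q))
                          ((holT (unitsField (toUField W)) (transl (transl (embIter (K - n) y) (((η : ℕ) : ℤ) • e ι)) q) [((t μ).getD i μ, false), (μ, true), Letter.rev ((t μ).getD i μ, false), (μ, false)] : (Matrix (Fin 2) (Fin 2) ℂ)ˣ) : Matrix (Fin 2) (Fin 2) ℂ)‖ ^ 2)) := by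
  classical
  have hV : ∀ b : PBond (F.P K) 0, ‖((unitsField (toUField W) b : (Matrix (Fin 2) (Fin 2) ℂ)ˣ) : Matrix (Fin 2) (Fin 2) ℂ)‖ ≤ 1
      ∧ ‖(((unitsField (toUField W) b)⁻¹ : (Matrix (Fin 2) (Fin 2) ℂ)ˣ) : Matrix (Fin 2) (Fin 2) ℂ)‖ ≤ 1 :=
    fun b => bicontr_of_mem_unitary _ (unitsField_toUField_mem_unitary W b.dir b.src)
  have hcard : ((Fintype.card (Fin ℓ') : ℝ))⁻¹ = (ℓ' : ℝ)⁻¹ := by rw [Fintype.card_fin]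
  refine Finset.sum_le_sum fun y _ => ?_
  have h1 := dirichlet_avg_axial_le_canonical_exact (unitsField (toUField W)) hV
    (fun η : Fin ℓ' => transl (embIter (K - n) y) (((η : ℕ) : ℤ) • e ι))
    (fun η : Fin ℓ' => R (holT (unitsField (toUField W)) (embIter (K - n) y) (seg ι ((η : ℕ) : ℤ)))⁻¹ (ψ (embIter (K - n) y)))
    (fun z => (∀ ν : Fin (F.P K).d, (y ν = (iterBlockOf (K - n) (fun κ => z κ - (((((F.P K).L ^ (K - n) - 1) / 2 : ℕ)) : ZMod ((F.P K).sitesPerDir 0)))) ν - 1 ∨ y ν = (iterBlockOf (K - n) (fun κ => z κ - (((((F.P K).L ^ (K - n) - 1) / 2 : ℕ)) : ZMod ((F.P K).sitesPerDir 0)))) ν ∨ y ν = (iterBlockOf (K - n) (fun κ => z κ - (((((F.P K).L ^ (K - n) - 1) / 2 : ℕ)) : ZMod ((F.P K).sitesPerDir 0)))) ν + 1 ∨ y ν = (iterBlockOf (K - n) (fun κ => z κ - (((((F.P K).L ^ (K - n) - 1) / 2 : ℕ)) : ZMod ((F.P K).sitesPerDir 0)))) ν + 2)))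
    (2 * (F.P K).L ^ (K - n) + ℓ') (fun z hz η μ ν => abs_rel_offset_le hk ℓ' hN y z hz η ι μ ν) s t hsplit hs ht
  rw [hcard] at h1
  simp only [canonical_letter_eq_transported _ hV] at h1
  exact h1

end T3

end Summit.QuantumFields.YangMills.Theorems.Prop7DirichletOfOffsetFamilyExact

end
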